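import Mathlib
import HarnessLib
import HarnessLib.Audit
import Summits.PneNP.Statement
import Literature.Computability.Complexity.Nondeterministic
import Literature.Computability.Complexity.Promise
import Literature.Computability.Complexity.ClayProblem
import Literature.Computability.Complexity.ClayProblemProofs
import Literature.Algebra.EuclideanLattices.LatticeComplexity

/-!
Route: Lattice

CLOSED (retired) 2026-08-16T05:13:33Z by planner-rbadge-PneNP-Lattice-b92fa31a-g3-0 — reason: bridge-only: one conjecture (GapSVP_n ∉ P) whose bridge to PneNP is proved and banked; crux floor unmeetable honestly; no importable premise decl for a declared conditional bridge; file-level cone not cleanable (gapSVPPromise lives with Gap — note: route-repair gen 3 (planner-rbadge-PneNP-Lattice-b92fa31a-g3-0), option (c): RETIRE as bridge-only. CENSUS. (1) Structure: the deciding theorem closes : LatticeGapsvpNNotP → LatticeGapsvpNMemPromiseNP → PneNP is PROVED (rev 7, native ok, standard axioms); its only research hypothesis is X = GapSVP_n. The file is kept as the record of this route; refuted decls are indexed as negative knowledge (`ledger negatives`).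

# Route Lattice — approximating the shortest lattice vector within factor n (the dimension) is not
in P

X (target `LatticeGapsvpNNotP`, "it suffices to show"): the promise problem GapSVP_n — given an
integer lattice basis B of rank n and a rational d, YES if λ₁(L(B)) ≤ d, NO if λ₁(L(B)) > n·d — is
not in PromiseP: no deterministic polynomial-time language separates YES from NO. With GapSVP_n ∈
PromiseNP (support `LatticeGapsvpNMemPromiseNP`, provable now from
Literature.Algebra.EuclideanLattices.gapSVP_mem_promiseNP_holds) the deciding theorem `closes :
LatticeGapsvpNNotP → LatticeGapsvpNMemPromiseNP → PneNP` is PROVED (glue.lean, six lines over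
P_bool_eq_holds / NP_bool_eq_holds); the Assembly item is literally its type. The line carries ONE
conjecture — polynomial-factor hardness of GapSVP, the founding conjecture of lattice cryptography
(Regev, ch. 15 of book:nguyen2009-lll-algorithm, p.482) — at its two published strengths as the
ranked cruxes, each of which implies X by a one-line argument checked in the planner's Sketch.lean:
#2 `LatticeGapsvpNNotBpp` (randomized machines, the sharp factor n: X by P ⊆ BPP) and #3
`LatticeThesis` (deterministic machines, uniformly over ALL polynomial factors γ ≥ 1 — the
Micciancio–Regev form: X by instantiating γ' = max n 1 and shrinking the no-set). Neither crux
implies the other; their refutation targets differ (a BPP algorithm at factor n vs a P algorithm at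
any factor n^c). No idea card (legacy survey route, repaired 2026-08-15).
Lean: `Literature.Algebra.EuclideanLattices.gapSVPPromise (fun n => (n : ℝ)) ∉
Literature.Computability.Complexity.PromiseP`

## Assembly
Pure logic over two proved model bridges. If GapSVP_n has an NP separating language L (support item)
then L ∈ NP Bool (NP_bool_eq_holds); were L ∈ P Bool then L ∈ Classes.P (P_bool_eq_holds) would
separate GapSVP_n inside PromiseP, contradicting X; hence L ∈ NP ∖ P, which is PneNP (Cook's form ∃
L ∈ NP, L ∉ P). The deciding theorem `closes : LatticeGapsvpNNotP → LatticeGapsvpNMemPromiseNP →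
_root_.PneNP` is in glue.lean (rc 0, axioms propext/Classical.choice/Quot.sound) and the Assembly
item below is literally its type, so it is closed by `fun h h' => closes h h'` the moment the file
lands. (Legacy form P_bool_eq → NP_bool_eq → P_subset_NP → LatticeThesis → PneNP, stmt-PneNP-0183
rev ≤ 5, restated: it consumed the uniform conjecture instead of the γ = n instance and carried the
unused, cone-blocking P_subset_NP; Literature.PQC.lattice_assembly_of_mem_promiseNP still proves
that legacy form modulo the support item.)

Rationale: WHY THIS LINE. It is the one strengthening of P ≠ NP whose evidence is geometric rather than
combinatorial and whose hard statement sits provably OUTSIDE the NP-hardness technique: for γ ≥ c√n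
GapSVP_γ ∈ NP ∩ coNP (AharonovRegev2005 Thm 1.1/Cor 1.2; tree:
Literature.Barriers.PneNP.LatticeGapCoNP), so a proof of X (or of either crux) must be a direct
lower bound for an NP∩coNP promise problem, informed by lattice structure (Minkowski, transference
Banaszczyk1993, discrete Gaussians) and by the algorithmic frontier (LLL/BKZ trade-off γ =
β^{Θ(n/β)}: poly time reaches only 2^{Θ(n log log n/log n)}, Regev ch. p.479; Peikert2016 §2.2), not
by SAT. The same statement is the foundation of lattice cryptography (Ajtai1996; MicciancioRegev2007
Thm 5.23; Regev2009; BLPRS2013 = arXiv:1306.0281), so BOTH outcomes are decisive: a proof of X gives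
P ≠ NP (a proof of #2 even NP ⊄ BPP), a refutation is a polynomial-factor lattice algorithm with
immediate cryptanalytic meaning. Imported area: geometry of numbers; no probabilistic/spectral
reformulation is claimed. Versus the sibling route LatticeMagic (certificate complexity of GapCVP at
CONSTANT factors, an NP ≠ coNP line): this route is the worst-case decision-hardness line at
POLYNOMIAL factor, and after this repair it carries no average-case (SIS/LWE/OWF) item — those are
Literature named facts (owfExist_of_gapSVP_worstCaseHard, blprs_gapSVP_sqrt_dim_to_lwe_classical),
not route items.

RANKED CRUXES. #0 LatticeGapsvpNNotP (target) — X itself: GapSVP_n ∉ PromiseP — no deterministic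
polynomial-time language contains the codes of all YES instances (λ₁ ≤ d) and of no NO instance (λ₁
> n·d). The deciding hypothesis of `closes`; implied by crux #2 (P ⊆ BPP: promiseLift_mono
P_subset_BPP_holds) and by crux #3 (γ' = max n 1,
Literature.PQC.gapSVPPromise_mem_promiseLift_of_le). (why it might fail: GapSVP_n may be in P
outright: for γ ≥ c√n it lies in NP∩coNP (AR05 Cor 1.2) so nothing known forbids it; block reduction
with β = log n already reaches 2^{O(n log log n/log n)} in poly time, and n-SVP in rank n reduces to
O(1)-SVP in rank n/2 (arXiv:2007.09556 p.3).) [book:nguyen2009-lll-algorithm p.482,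
AharonovRegev2005, Peikert2016, arXiv:2007.09556]
#2 LatticeGapsvpNNotBpp (crux) — approximating λ₁ within factor n (the dimension) is not even in
promise-BPP (strong class promiseLift BPP, hence the WEAKER of the two readings; the textbook
PromiseBPP' form is also open). Above the Aharonov–Regev √n threshold, so NP-hardness cannot be the
mechanism; exactly the regime of the worst-case→average-case reductions, so a refutation is a
cryptanalytic event. Implies the target by P ⊆ BPP. [difficulty: open-problem] (why it might fail:
GapSVP_n may simply be in BPP: γ = n ≥ c√n lies in NP∩coNP (AR05 Cor 1.2), so an algorithm
contradicts nothing known; no lower-bound technique against general poly-time machines exists;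
n-approx SVP is exact SVP in rank ≈ n/2 (arXiv:2007.09556), 2^{Θ(n)} today, not provably.)
[AharonovRegev2005, book:nguyen2009-lll-algorithm p.482, Peikert2016, arXiv:2007.09556, Regev2009,
arXiv:1306.0281, Literature.Barriers.PneNP.LatticeGapCoNP]
#3 LatticeThesis (crux) — the Micciancio–Regev conjecture in its uniform deterministic form: for
EVERY polynomially bounded γ with γ(n) ≥ 1, GapSVP_γ ∉ PromiseP. A strict strengthening of the
target along the factor axis (an infinite conjunction over exponents c), neither implying nor
implied by #2; it is the statement the literature actually poses (Regev ch. p.482: "is there an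
efficient algorithm for approximating lattice problems to within polynomial factors?") and the one a
classical-LWE algorithm would wound through BLPRS2013. Item stmt-PneNP-0182, re-badged target→crux
now that the Assembly consumes the γ = n instance instead of X. [difficulty: open-problem] (why it
might fail: Infinite conjunction over exponents c: dies if GapSVP_{n^c} ∈ P for ONE c; above c√n no
NP-hardness backstop (AR05 Cor 1.2); n^c-approximate SVP in rank n is O(1)-SVP in rank n/(c+1)
(arXiv:2007.09556 p.3), so large c is genuinely easier; sole evidence is algorithmic failure.)
[book:nguyen2009-lll-algorithm p.482 and p.479 (Regev ch. 15), AharonovRegev2005, Peikert2016,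
arXiv:2007.09556, arXiv:1306.0281, Khot2005]
#9 LatticeGapsvpNMemPromiseNP (support) — GapSVP_n ∈ PromiseNP: a nonzero lattice vector of norm ≤ d
is the NP witness. Provable now: Literature.Algebra.EuclideanLattices.gapSVP_mem_promiseNP_holds
gives it for every γ ≥ 1; γ = n fails 1 ≤ γ 0, patched by GapSVP_{max n 1} having the same yes-set
and, for n ≥ 1, the same no-set, while no dimension-0 instance is a no-instance of GapSVP_n
(Literature.PQC.not_mem_gapSVP_no_natCast_of_n_eq_zero). Second hypothesis of `closes` (item
stmt-PneNP-0185, ledger rank 3). [difficulty: provable-now] [AharonovRegev2005 p.2,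
MicciancioGoldwasser2002 Ch.1 §1.2, Literature.Algebra.EuclideanLattices.gapSVP_mem_promiseNP_holds]

TWO-LAYER PLAN. None filed. The only glue in the route is proved. Two one-line lemmas crux ⇒ target
are available to any prover and need no items: LatticeThesis → LatticeGapsvpNNotP and
LatticeGapsvpNNotBpp → LatticeGapsvpNNotP (both checked in the planner's Sketch.lean; file them with
--supports). If tenure ever adopts a restricted-model programme for #2, the foreseen split is #2 ⇐
(BlockReductionFloor: every polynomial-time block-reduction strategy with block size β = O(log n)
outputs ‖b₁‖ ≥ β^{c·n/β}·λ₁ on some lattice family — provable geometry, Schnorr1987/GamaNguyen2008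
tightness) → (model completeness — not typeable today), recorded here only so nobody files
BlockReductionFloor as if it implied #2.

KILL CRITERIA. - ¬X = ¬LatticeGapsvpNNotP (a deterministic polynomial-time factor-n GapSVP
algorithm) closes the route `refuted:LatticeGapsvpNNotP` and refutes both cruxes with it (each
implies X). Single kill switch.
- ¬#2 (a randomized factor-n algorithm) kills the line in substance (only a derandomization gap
would remain): close `refuted:LatticeGapsvpNNotBpp` unless the refuting algorithm is specific to γ =
n·ω(1) slack, in which case restate at γ = n log n is NOT allowed (cosmetic) — close.
- ¬#3 via GapSVP_{n^c} ∈ P for some c > 1 only: LatticeThesis refuted-substantive as the uniform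
conjecture; the bridge (target, #2) survives — repair = `--drop LatticeThesis`, record the exponent
c in the rationale; under the floor again ⇒ declare the conditional bridge then (see NOT DECOMPOSED
YET (vii)).
- LWE_{n, q = poly} ∈ BPP would, through BLPRS2013 Thm 1.1 (tree:
blprs_gapSVP_sqrt_dim_to_lwe_classical), put GapSVP_{poly(m)} in BPP in dimension m = √n: evidence
kill for #3, recorded, no automatic close.
- Proved elsewhere moots it: any PneNP proof; NP ⊄ BPP proved elsewhere does NOT moot #2 (GapSVP_n
is not NP-hard unless NP ⊆ coNP).

NOT DECOMPOSED YET. Deliberately outside the route after this repair: (i) the average-case layer —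
SIS/LWE and one-way functions from worst-case hardness (Ajtai1996, MicciancioRegev2007 Thm 5.23,
Regev2009, BLPRS2013): these are Literature NAMED FACTS (owfExist_of_gapSVP_worstCaseHard in its
faithful infinitely-often/PromiseBPP' form; blprs_gapSVP_sqrt_dim_to_lwe_classical) whose
conclusions are conjecture constants (OWFExist), so they are cited, never filed as items (the
dropped stmt-PneNP-0186 over-claimed them: all-dimensions + promiseLift-BPP hypothesis, grounder
MISMATCH); (ii) the textbook-class variant of #2 (PromiseBPP' — also open; PromiseP ⊆ PromiseBPP' is
proved, PromiseP_subset_PromiseBPP'); (iii) restricted-model lower bounds (block reduction, sieving,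
enumeration) — evidence for #2, never implying it; (iv) ℓ_p, SIVP and CVP variants (GapCVP
certificate complexity belongs to route LatticeMagic); (v) the quantum side (summit QuantumAdvantage
owns LWENotInBQP / GapSVPQuantumHardness); (vi) Regev's evidence programme Factoring ≤ GapSVP_{n²}
(Regev ch. p.482) — open, evidence only; (vii) STRUCTURE NOTE for tenure: in substance this is ONE
conjecture at three strengths (target ⊂ #2, target ⊂ #3), i.e. a conditional bridge on
LatticeGapsvpNNotP whose bridge is proved; the `conditional_bridge` flag is not set because
`conditional_on` must name an EXISTING declaration (the gate renders `attribute [route_premise]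
<decl>` above the item defs, so it can name neither this route's own item nor a bib key — verified
with `ledger route check --native` — and no Literature/Theorems conjecture decl for classical
polynomial-factor GapSVP hardness exists, only the quantum `GapSVPQuantumHardness`). If a retriage
ever merges #3 into #2, the move is: have a definer land `@[conjecture] def` with the target's
signature under Summits/PneNP/PneNP/Theorems, then `route edit` with {conditional_bridge: true,
conditional_on: <that decl>}.

CHEAPEST FALSIFIER. For the bridge: none left — `closes` elaborates (rc 0) and the support item
follows from gapSVP_mem_promiseNP_holds. For the conjecture: (1) the encoding audit of gapSVPPromise
at n = 0, 1 (done: dimension 0 has no no-instances,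
Literature.PQC.not_mem_gapSVP_no_natCast_of_n_eq_zero, so γ(0) = 0 creates no degenerate refutation;
dimension 1 is decidable exactly but is one slice, not a language in P separating ALL dimensions);
(2) a literature check that no polynomial-time algorithm is known within ANY polynomial factor
(confirmed: Regev ch. p.479/482 — best 2^{n log log n/log n}; Peikert2016 §2.2; arXiv:2007.09556) —
the refuter's first ten minutes; anything cheaper does not exist, which is the honest status of an
open conjecture.

NUMBERS. Poly-time approximation frontier 2^{Θ(n log log n/log n)} (Schnorr block reduction +
sieving in blocks; Regev ch. p.479; Peikert2016 p.10); factor β^{Θ(n/β)} costs 2^{Θ(β)}·poly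
(BKZ/slide reduction); NP-hardness: GapCVP up to n^{c/log log n} (Dinur–Kindler–Raz–Safra,
deterministic; AharonovRegev2005 p.1), GapSVP for every constant (Khot2005, randomized) and up to
2^{(log n)^{1−ε}} under randomized quasi-polynomial reductions (HavivRegev2007; Regev ch. p.479); NP
∩ coAM from √(n/log n) (GoldreichGoldwasser2000), NP ∩ coNP from c√n (AharonovRegev2005 Thm 1.1);
n^c-approximate SVP in rank n ↔ O(1)-SVP in rank n/(c+1) (arXiv:2007.09556 p.3); classical LWE
hardness from GapSVP_{poly(m)} in dimension m = √n (arXiv:1306.0281 Thm 1.1).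

DEFINITION REQUESTS. None. (SIS is still untyped in Literature; not needed by any item after the
repair.)

Novelty: Searches (2026-08-13/14 by the survey and retriage planners: lit search / --hybrid / vsearch
"polynomial-factor lattice hardness", lit frontier PneNP, lit bridges PneNP, lean search; 2026-08-15
this repair: lit search --hybrid "Micciancio Regev conjecture polynomial factors" (10 book hits,
none closer than the held Regev chapter), lit read book:nguyen2009-lll-algorithm pp.475–484 (p.479
frontier numbers, p.482 the conjecture and the Factoring ≤ GapSVP_{n²} programme), ledger negatives
--problem PneNP (4 refuted statements, none about lattices)).
Nearest prior art found: the thesis X is verbatim the standing conjecture of lattice cryptography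
(book:nguyen2009-lll-algorithm p.482; Peikert2016 §2.2; MicciancioGoldwasser2002 Ch.1); X ⇒ P ≠ NP
is folklore (GapSVP ∈ NP trivially, AharonovRegev2005 p.2) and is now machine-checked in the tree
(Literature.PQC.pneNP_of_gapSVP_notMem_promiseP_of_mem_promiseNP; gapSVP_mem_promiseNP_holds);
placing the crux at γ = n above the NP∩coNP threshold (AharonovRegev2005 Cor 1.2) and the
worst-case→average-case reading (Ajtai1996, MicciancioRegev2007, Regev2009, arXiv:1306.0281) are
textbook; conditional lower bounds exist only near γ ≈ 1–2 (arXiv:1712.00942, arXiv:2109.04025,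
arXiv:2511.01626).
Delta: none in mechanism — the route is the typed, machine-checked bridge "polynomial-factor GapSVP
hardness ⇒ P ≠ NP" (in substance a conditional bridge) with its hard statements placed provably
outside the NP-hardness technique; its value is positional (  [refs: 1306.0281, 1712.00942, 2109.04025, 2511.01626, book:nguyen2009-lll-algorithm, Peikert2016, MicciancioGoldwasser2002, AharonovRegev2005, Ajtai1996, MicciancioRegev2007, Regev2009]

Barriers (technique_class: worst-case-lattice-hardness, gapsvp, geometry-of-numbers): - technique_class: worst-case-lattice-hardness, gapsvp, geometry-of-numbers
- Literature.Barriers.PneNP.LatticeGapCoNP: APPLIES head-on and is conceded, not evaded: γ = n ≥ c√n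
for n ≥ c², so Karp- or Cook-NP-hardness of GapSVP_n would give NP ⊆ coNP
(LatticeGapCoNP.np_subset_coNP_of_isNPHard_gapSVP / _of_isNPHardCook_gapSVP; AharonovRegev2005 App.
B); X and both cruxes must therefore be DIRECT lower bounds for an NP∩coNP promise problem — the bet
is that the transference/discrete-Gaussian structure that proves the coNP bound can be turned
against algorithms; no such technique is known.
- Literature.Barriers.PneNP.Relativization: applies by inheritance (X ⇒ P ≠ NP through the proved
bridge; #2 ⇒ NP ⊄ BPP): a proof must be non-relativizing; lattice geometry is not per se
relativizing, but no argument against arbitrary polynomial-time machines exists — it does not evade;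
the bet is on problem-specific structure.
- Literature.Barriers.PneNP.BoundedRelativization: same inheritance as Relativization; not evaded.
- Literature.Barriers.PneNP.Algebrization: same inheritance (a fortiori not an algebrizing
separation of NP from P); not evaded.
- Literature.Barriers.PneNP.NaturalProofs: hits any circuit-lower-bound proof of X or the cruxes and
is self-undermining here: if the line's own average-case reading holds (SIS/LWE hard), low-depth
lattice PRFs exist (BPR12, doi:10.1007/978-3-642-29011-4_42) ⇒ HardPRGExist; a proof must be
non-natural. Not evaded.
- Literature.Barriers.PneNP.NPHa

Novelty grade: known — route-review grade (refuter-rreview1-PneNP-Lattice-b92fa31a-0, 2026-08-15). KNOWN: target X (GapSVP_n ∉ P) and crux #3 (∀ poly γ) are verbatim the standing conjecture of lattice crypto (Regev ch.15 p.482); crux #2 is its randomized strength (SIS/LWE regime, Regev2009/BLPRS2013); bridge X ⇒ P≠NP is f (refuter refuter-rreview1-PneNP-Lattice-b92fa31a-0, 2026-08-15T18:16:10Z; prior: book:nguyen2009-lll-algorithm p.482 (Regev ch.15: poly-factor GapSVP hardness conjecture = X/#3 verbatim), AharonovRegev2005 p.2 + Cor 1.2 (GapSVP ∈ NP trivially ⇒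 X ⇒ P≠NP folklore; c√n coNP threshold), MicciancioRegev2007 Def 2.2 / MicciancioGoldwasser2002 Ch.1 §1.2 (GapSVP_γ), Peikert2016 §2.2 p.10 (frontier 2^{Θ(n log log n/log n)}), Regev2009; arXiv:1306.0281 (average-case reading of #2))

History (route lifecycle, newest last):
- 2026-08-15T16:59:50Z · rev 7: restated Assembly (stmt-PneNP-0183) — route-repair (gen 2, planner-rbadge-PneNP-Lattice-b92fa31a-g2-0), part 2/2 (part 1 = rev 6: re-badge 0182 target→crux, novelty/barriers): REROUTED AROUND the un (planner-rbadge-PneNP-Lattice-b92fa31a-g2-0)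
- 2026-08-15T16:59:50Z · rev 7: dropped stmt-PneNP-0186 — route-repair (gen 2, planner-rbadge-PneNP-Lattice-b92fa31a-g2-0), part 2/2 (part 1 = rev 6: re-badge 0182 target→crux, novelty/barriers): REROUTED AROUND the un (planner-rbadge-PneNP-Lattice-b92fa31a-g2-0)
- 2026-08-16T04:14:11Z · AUTO-CRUX (backfill): LatticeGapsvpNNotP — hypotheses of the deciding theorem that nothing in the route derives are cruxes (operator:999:1085951)
- 2026-08-16T05:13:34Z · CLOSED retired — bridge-only: one conjecture (GapSVP_n ∉ P) whose bridge to PneNP is proved and banked; crux floor unmeetable honestly; no importable premise decl for a declared conditional bridge; file-level cone not (planner-rbadge-PneNP-Lattice-b92fa31a-g3-0)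

sub-problem: PneNP · status: closed(retired) · opened planner-PneNP-Survey-0 2026-08-13T06:07:35Z · rev 7 · ledger route-PneNP-Lattice
GENERATED by the gate from the ledger (D-0016/17). Provers cite these decls: `theorem foo : Summit.PneNP.PneNP.Theses.Lattice.<Decl> := …` in Summits/PneNP/PneNP/Theorems/<Name>.lean.
-/

namespace Summit.PneNP.PneNP.Theses.Lattice

open scoped BigOperators Topology Manifold Classical MeasureTheory ProbabilityTheory Matrix InnerProductSpace ComplexConjugate ContinuousMap
open Filter Set Function TopologicalSpace MeasureTheory

attribute [summit_statement] _root_.PneNP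

open Literature.PNP

/-- item stmt-PneNP-0182 · crux · rank 0 · closed · moot by None · by planner
why it might fail: Infinite conjunction over exponents c: dies if GapSVP_{n^c} ∈ P for ONE c; above c√n no NP-hardness backstop (AR05 Cor 1.2); n^c-approximate SVP in rank n is O(1)-SVP in rank n/(c+1) (arXiv:2007.09556 p.3), so large c is genuinely easier; sole evidence is algorithmic failure.
sources: book:nguyen2009-lll-algorithm p.482 and p.479 (Regev ch. 15), AharonovRegev2005, Peikert2016, arXiv:2007.09556, arXiv:1306.0281, Khot2005
Route thesis of PneNP/Lattice: no deterministic polynomial-time algorithm approximates the shortest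
vector of an integer lattice within any polynomial factor (classical analogue of
Literature.Algebra.EuclideanLattices.GapSVPQuantumHardness; Peikert 2016 §4; Micciancio–Goldwasser
2002 Ch. 1). [sources: Peikert2016; MicciancioGoldwasser2002; Regev2009] [route PneNP/Lattice, rank
0] -/
@[route_item "route-PneNP-Lattice"]
def LatticeThesis : Prop :=
  ∀ γ : ℕ → ℝ, Literature.Algebra.EuclideanLattices.IsPolyBoundedReal γ → (∀ n, 1 ≤ γ n) → Literature.Algebra.EuclideanLattices.gapSVPPromise γ ∉ Literature.Computability.Complexity.PromiseP

/-- item stmt-PneNP-11282 · crux (kind.auto-crux: conjecture-grade) · rank 0 · closed · moot by None · by planner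
why it might fail: GapSVP_n may be in P outright: for γ ≥ c√n it lies in NP∩coNP (AR05 Cor 1.2) so nothing known forbids it; block reduction with β = log n already reaches 2^{O(n log log n/log n)} in poly time, and n-SVP in rank n reduces to O(1)-SVP in rank n/2 (arXiv:2007.09556 p.3).
sources: book:nguyen2009-lll-algorithm p.482, AharonovRegev2005, Peikert2016, arXiv:2007.09556
[target] X itself: GapSVP_n ∉ PromiseP — no deterministic polynomial-time language contains the
codes of all YES instances (λ₁ ≤ d) and of no NO instance (λ₁ > n·d). The deciding hypothesis of
`closes`; implied by crux #2 (P ⊆ BPP: promiseLift_mono P_subset_BPP_holds) and by crux #3 (γ' = max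
n 1, Literature.PQC.gapSVPPromise_mem_promiseLift_of_le). -/
@[route_item "route-PneNP-Lattice"]
def LatticeGapsvpNNotP : Prop :=
  Literature.Algebra.EuclideanLattices.gapSVPPromise (fun n => (n : ℝ)) ∉ Literature.Computability.Complexity.PromiseP

/-- item stmt-PneNP-0184 · crux · rank 2 · closed · moot by None · by planner
why it might fail: GapSVP_n may simply be in BPP: γ = n ≥ c√n lies in NP∩coNP (AR05 Cor 1.2), so an algorithm contradicts nothing known; no lower-bound technique against general poly-time machines exists; n-approx SVP is exact SVP in rank ≈ n/2 (arXiv:2007.09556), 2^{Θ(n)} today, not provably.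
sources: AharonovRegev2005, book:nguyen2009-lll-algorithm p.482, Peikert2016, arXiv:2007.09556, Regev2009, arXiv:1306.0281
Approximating λ₁ within factor n (dimension) is not in promise-BPP. Above Aharonov–Regev's √n coNP
threshold [AharonovRegev2005, Thm 1.1], so NP-hardness cannot be the mechanism [Khot2005 covers
constants only]; the regime of Regev/BLPRS worst-case-to-average-case reductions [Regev2009;
BLPRS2013]. Hardest and most informative crux. [sources: AharonovRegev2005; Khot2005; Regev2009;
BLPRS2013] [route PneNP/Lattice, rank 2] -/
@[route_item "route-PneNP-Lattice"]
def LatticeGapsvpNNotBpp : Prop :=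
  Literature.Algebra.EuclideanLattices.gapSVPPromise (fun n => (n : ℝ)) ∉ Literature.Computability.Complexity.PromiseBPP

/-- item stmt-PneNP-0185 · support · rank 3 · closed · moot by None · by planner
sources: AharonovRegev2005 p.2 ('containment in NP is trivial'; lit paper:doi-10-1109-focs-2004-35), lit book:nguyen2009-lll-algorithm p.481 (Regev ch.: NP witness = short/close lattice vector; stated for GapCVP, holds for GapSVP via the appendix), Literature.Algebra.EuclideanLattices.gapSVP_sqrt_mem_promiseNP_inter_promiseCoNP + Literature.Barriers.PneNP.gapSVPPromise_mem_promiseLift_mono (LatticeGapCoNP.lean:138): named-fact shortcut for dimensions n ≥ c² (c√n ≤ n); small n need the direct witness, Literature.PQC.lattice_assembly_of_mem_promiseNP (Summits/PneNP/PneNP/Theorems/LatticeAssembly.lean:74: Assembly 0183 closes the moment this lands)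
A nonzero lattice vector of norm ≤ d is an NP witness separating yes-instances (λ₁ ≤ d) from
no-instances (λ₁ > n d) [MicciancioGoldwasser2002, Ch. 1 §1.2]. Needed by the assembly; exercises
the encodings gapSVPInstanceEncoding / promiseLift. [sources: MicciancioGoldwasser2002] [route
PneNP/Lattice, rank 3] -/
@[route_item "route-PneNP-Lattice"]
def LatticeGapsvpNMemPromiseNP : Prop :=
  Literature.Algebra.EuclideanLattices.gapSVPPromise (fun n => (n : ℝ)) ∈ Literature.Computability.Complexity.PromiseNP

-- earlier Assembly (stmt-PneNP-0183, replaced 2026-08-15T16:59:50Z -> stmt-PneNP-11281): retired by None — Literature.Computability.Complexity.P_bool_eq → Literature.Computability.Complexity.NP_bool_eq → Literature.Computability.Complexity.P_subset_NP → (∀ γ : ℕ → ℝ, Literature.Algebra.EuclideanLattices.IsPolyBoundedReal γ → (∀ n, 1 ≤ γ n) → Literature.Algebra.EuclideanLattices.gapSVPPromise γ ∉ Lit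
/-- item stmt-PneNP-11281 · assembly · rank 1 · closed · moot by None · by planner
[assembly] honest form after the 2026-08-15 repair: LatticeGapsvpNNotP → LatticeGapsvpNMemPromiseNP
→ PneNP (bodies inlined). Literally the type of the deciding theorem `closes` (glue.lean), hence
closed by `theorem assembly_holds : Summit.PneNP.PneNP.Theses.Lattice.Assembly := fun h h' =>
Summit.PneNP.PneNP.Theses.Lattice.closes h h'` the moment the file lands. Replaces the legacy form
P_bool_eq → NP_bool_eq → P_subset_NP → LatticeThesis → PneNP (it consumed the uniform conjecture
instead of the γ = n instance and carried the unused, cone-blocking P_subset_NP;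
Literature.PQC.lattice_assembly_of_mem_promiseNP proves that legacy form modulo stmt-PneNP-0185).
[sources: MicciancioGoldwasser2002 Ch.1 §1.2; CookClay2006 §1] -/
@[route_item "route-PneNP-Lattice"]
def Assembly : Prop :=
  Literature.Algebra.EuclideanLattices.gapSVPPromise (fun n => (n : ℝ)) ∉ Literature.Computability.Complexity.PromiseP → Literature.Algebra.EuclideanLattices.gapSVPPromise (fun n => (n : ℝ)) ∈ Literature.Computability.Complexity.PromiseNP → _root_.PneNP

end Summit.PneNP.PneNP.Theses.Lattice
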